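import Summits.BirchSwinnertonDyer.Rank1Residual.X9.TransportHasseWeil
import Summits.BirchSwinnertonDyer.Rank1Residual.X9.TransportSweepA
import Summits.BirchSwinnertonDyer.Rank1Residual.X9.TransportSweepB
import Summits.BirchSwinnertonDyer.Rank1Residual.X9.TransportSweepC
import HarnessLib

/-!
# Class X9, `p = 5`: congruence-transport records RE-KEYED on the Hasse–Weil twin of Kraus–Oesterlé Prop. 4 — part A (6 records; KO92 R-20 repair, step 2)

HONEST FRAMING (cell `b2b-bsdres-*`, verbatim): the cell deletes COMBINATION-SHAPED residual classes of
the rank-≤1 BSD formula from PUBLISHED theorems only and TYPES the construction-shaped remainder; this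
is not "finishing BSD". Class X9 (good ordinary `p ≥ 5`, `ρ̄_{E,p}` irreducible and not surjective) stays
TYPED at class level; everything here is PER PAIR (or generic); no lane verdict is changed; no named fact is
introduced; nothing is booked by this unit (the lane books, the referee rules). Unit `b2b-bsdres-x9`, gen 47.

## Why (the KO92 clause defect, ARM-P register R-20 `KO92-Prop4-(ii)b-frobeniusTrace-offset`, 2026-08-27)

The cited-facts audit (`pub/bsd-cited`, sheet `D-AUDIT-r07-Q41-KO92-LS18.md`) found that
`KrausOesterle1992.prop4_torsionIso_of_congruences` types Prop. 4 (ii)'s clause "`ℓ ∣ NN'`, `ℓ² ∤ NN'` ⇒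
`a_ℓ a'_ℓ ≡ ℓ + 1 (mod p)`" over the tree's `frobeniusTrace`, which at the multiplicative curve of such a pair is
`2` / `0` (`= 1 + a_ℓ`; `X11b.LocalTorsion.frobeniusTrace_eq_two_of_split` / `…_zero_of_nonsplit`), not the
Hasse–Weil `a_ℓ = ±1` the paper multiplies (Math. Ann. 293, p. 263 L8–9). Every X9 congruence-transport record displays
that list on a pair whose `N_E·N_A` has a simple prime far below `μ(M)/6` (x9 GEN 47 owner census: 35 / 35 EXPOSED),
so each is VACUOUS AS TYPED, while its two-engine certificate (Hasse–Weil `a_ℓ`) stands. The typing layer lands the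
corrected twin `KrausOesterle1992.prop4_torsionIso_of_congruences_hasseWeil` (target T-Q41-1; the `= 1 →` conjunct over
`W.LFunction ℓ * W'.LFunction ℓ`, Mathlib's `WeierstrassCurve.LFunction` having the Hasse–Weil `a_ℓ` as prime
coefficient at EVERY prime); the X9 lane re-keys its consumers on it: step 0 `X9/TransportTorsionIso.lean` (p494287,
consumers keyed on the isomorphism), step 1 `X9/TransportHasseWeil.lean` (generic), step 2 these record files.

## Records in this part (each = the original's statement with `hKO` := the twin and ONE token in `hcong`; proof = the original's, through the `_hasseWeil` generic layer; the originals stay in the tree byte-identical — their status as closed statements is ARM-P target T-Q41-2's, not this lane's)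

* `bsdp_t129472bl1_of_bsdp_s55488t1_hasseWeil` ← `X9/TransportSweepA.lean`'s `bsdp_t129472bl1_of_bsdp_s55488t1` (129472bl1 ← 55488t1; exposing prime(s) 3, 7)
* `bsdp_t129472cz1_of_bsdp_s55488cs1_hasseWeil` ← `X9/TransportSweepB.lean`'s `bsdp_t129472cz1_of_bsdp_s55488cs1` (129472cz1 ← 55488cs1; exposing prime(s) 3, 7)
* `bsdp_t169932f1_of_bsdp_s56644j1_hasseWeil` ← `X9/TransportSweepB.lean`'s `bsdp_t169932f1_of_bsdp_s56644j1` (169932f1 ← 56644j1; exposing prime(s) 3)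
* `bsdp_t17328j1_of_bsdp_s5776a1_hasseWeil` ← `X9/TransportSweepB.lean`'s `bsdp_t17328j1_of_bsdp_s5776a1` (17328j1 ← 5776a1; exposing prime(s) 3)
* `bsdp_t177744dj1_of_bsdp_s8464f1_hasseWeil` ← `X9/TransportSweepC.lean`'s `bsdp_t177744dj1_of_bsdp_s8464f1` (177744dj1 ← 8464f1; exposing prime(s) 3, 7)
* `bsdp_t184512bq1_of_bsdp_s61504r1_hasseWeil` ← `X9/TransportSweepC.lean`'s `bsdp_t184512bq1_of_bsdp_s61504r1` (184512bq1 ← 61504r1; exposing prime(s) 3)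

No certificate is recomputed: the engines (PARI `ellap`; ENGINE D) computed Hasse–Weil `a_ℓ` — print's clause — in the kits named
in each docstring. References: as in the original files; Kraus–Oesterlé, Math. Ann. 293 (1992) Prop. 4 (ii), pp. 263–264.
-/

set_option autoImplicit false

noncomputable section

open scoped Classical MatrixGroups ModularForm

open CongruenceSubgroup WeierstrassCurve Literature.NumberTheory.EllipticCurves
  Literature.NumberTheory.EllipticCurves.ModularForms Literature.NumberTheory.EllipticCurves.Rank1Residual
  Literature.NumberTheory.EllipticCurves.Rank1Residual.Typed
  Literature.NumberTheory.EllipticCurves.Rank1Residual.X11RankOneCertificates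
  Summit.BirchSwinnertonDyer.BirchSwinnertonDyer.Rank1Residual.IntModel
  Summit.BirchSwinnertonDyer.BirchSwinnertonDyer.Rank1Residual.X11RankOne
  Summit.BirchSwinnertonDyer.Rank1Residual.X11b

namespace Summit.BirchSwinnertonDyer.Rank1Residual.X9

/-! ### The re-keyed records -/

/-- **`BSD(E,5)`-side record for `129472bl1` from `55488t1`, RE-KEYED on the Hasse–Weil twin of Kraus–Oesterlé Prop. 4** (ARM-P register
R-20 `KO92-Prop4-(ii)b-frobeniusTrace-offset`; x9 GEN 47 census `HOME/b2b-bsdres-x9/g47/KO92-EXPOSURE-X9.md`): the record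
`bsdp_t129472bl1_of_bsdp_s55488t1` of `X9/TransportSweepA.lean` — same Cremona models, same kernel-decided data (its `card_*` / `isElliptic_*` /
`isGloballyMinimal_*` theorems are imported, not re-proved), same PUBLISHED and FINITE binders (see that docstring for every number) —
with (i) `hKO` := the corrected statement `KrausOesterle1992.prop4_torsionIso_of_congruences_hasseWeil` and (ii) the `v_ℓ(N_E N_A) = 1`
conjunct of the displayed list `hcong` over `W.LFunction ℓ * A.LFunction ℓ` — Mathlib's `WeierstrassCurve.LFunction`, whose prime
coefficient is the HASSE–WEIL `a_ℓ`, `= ±1` at the multiplicative curve (Kraus–Oesterlé, Math. Ann. 293, p. 263 L8–9) — instead of the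
tree's `frobeniusTrace` (`= 2 / 0` there, `X11b.LocalTorsion.frobeniusTrace_eq_two_of_split` / `…_zero_of_nonsplit`), which made the
original's `hcong` unsatisfiable at the simple prime(s) ℓ ∈ {3, 7} of `N_E·N_A` and the original VACUOUS AS TYPED. Hasse–Weil `a_ℓ` is the
currency in which the two engines (PARI `ellap`; ENGINE D pure-Python BSGS/Mestre; kit j130867) CERTIFIED the list: no certificate changes.
Per pair; nothing booked; X9 stays typed. [cite: KrausOesterle1992, Prop. 4 (ii), pp. 263–264] [cite: GreenbergVatsal2000, Thm. (1.4) (arXiv p. 5)]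
[cite: Cremona2006, Table 1 (Cremona labels 129472bl1, 55488t1)] -/
theorem bsdp_t129472bl1_of_bsdp_s55488t1_hasseWeil
    (hKO : KrausOesterle1992.prop4_torsionIso_of_congruences_hasseWeil)
    (hBCS : burungale_castella_skinner_charIdeal_eq_padicLFunction)
    (hGr : greenberg_charValue_rankZero) (h5 : realPeriodRat_eq_unit_mul_plusPeriod)
    (hGV : GreenbergVatsal2000.thm14_mainConjecture_transfer_of_torsionIso)
    (hS : Schneider1985_order_charGenerator) (hPR : perrinRiou_rankOne_leadingTerms)
    (hmodP : nonempty_modularParametrizationData) (hmodL : hasEntireLFunction_rat)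
    (hGZK : rank_eq_analyticRank_of_analyticRank_le_one)
    (W A : WeierstrassCurve ℚ) [W.IsElliptic] [W.IsGloballyMinimal] [A.IsElliptic] [A.IsGloballyMinimal]
    [Fact (Nat.Prime 5)]
    (hW : W = ⟨0, 1, 0, -14257, 608527⟩) (hA : A = ⟨0, -1, 0, 26203, 1154373⟩)
    (hran : W.analyticRank ≤ 1) (hrA : A.analyticRank ≤ 1) (hbsdA : BSDp A 5)
    (hSchA : A.analyticRank = 1 → ∀ Dh : PAdicHeightData A 5, Dh.IsCanonical → SchneiderConjecture Dh)
    (hcertA : ∀ [NeZero (A.conductorNorm ℤ)] (fA : CuspForm (Gamma0 (A.conductorNorm ℤ)) 2),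
        IsNewformOf A fA → ∀ (ϖ : ℚ), (ϖ : ℝ) * A.realPeriodRat = plusPeriod fA →
      ∃ n : ℕ, ‖PowerSeries.coeff n
        (PowerSeries.C (ϖ : ℚ_[5]) * padicLFunction fA (unitRoot A 5 : ℚ_[5]))‖ = 1)
    (hcong : ∀ (ℓ : ℕ) [Fact ℓ.Prime],
      6 * ℓ < KrausOesterle1992.gammaZeroIndex (KrausOesterle1992.modulus W A) →
      (padicValNat ℓ (W.conductorNorm ℤ * A.conductorNorm ℤ) = 0 →
          (5 : ℤ) ∣ W.frobeniusTrace ℓ - A.frobeniusTrace ℓ) ∧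
        (padicValNat ℓ (W.conductorNorm ℤ * A.conductorNorm ℤ) = 1 →
          (5 : ℤ) ∣ W.LFunction ℓ * A.LFunction ℓ - (ℓ + 1)))
    (hC3 : W.analyticRank = 1 → ∀ Dh : PAdicHeightData W 5, Dh.IsCanonical → SchneiderConjecture Dh) :
    BSDp W 5 := by
  have hIW : integralModelInt W = ⟨0, 1, 0, -14257, 608527⟩ :=
    integralModelInt_eq_of_map_eq _ (by rw [hW]; ext <;> simp [WeierstrassCurve.map])
  have hIA : integralModelInt A = ⟨0, -1, 0, 26203, 1154373⟩ :=
    integralModelInt_eq_of_map_eq _ (by rw [hA]; ext <;> simp [WeierstrassCurve.map])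
  haveI : Fact (Nat.Prime 11) := ⟨by norm_num⟩
  exact bsdp_of_ainvs_of_bsdpPartner_of_congruences_of_analyticRank_le_one_hasseWeil hKO hBCS hGr h5 hGV hS hPR hmodP hmodL hGZK
    0 1 0 (-14257) 608527 hIW
    0 (-1) 0 26203 1154373 hIA
    5 11 8 4 4 (by norm_num) (by decide +kernel) card_t129472bl1_5 (by decide) (by decide)
    (by decide +kernel) card_t129472bl1_11 (by decide) (by decide +kernel) card_s55488t1_5 (by decide)
    hran hrA hbsdA hSchA hcertA hcong hC3

/-- **`BSD(E,5)`-side record for `129472cz1` from `55488cs1`, RE-KEYED on the Hasse–Weil twin of Kraus–Oesterlé Prop. 4** (ARM-P register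
R-20 `KO92-Prop4-(ii)b-frobeniusTrace-offset`; x9 GEN 47 census `HOME/b2b-bsdres-x9/g47/KO92-EXPOSURE-X9.md`): the record
`bsdp_t129472cz1_of_bsdp_s55488cs1` of `X9/TransportSweepB.lean` — same Cremona models, same kernel-decided data (its `card_*` / `isElliptic_*` /
`isGloballyMinimal_*` theorems are imported, not re-proved), same PUBLISHED and FINITE binders (see that docstring for every number) —
with (i) `hKO` := the corrected statement `KrausOesterle1992.prop4_torsionIso_of_congruences_hasseWeil` and (ii) the `v_ℓ(N_E N_A) = 1`
conjunct of the displayed list `hcong` over `W.LFunction ℓ * A.LFunction ℓ` — Mathlib's `WeierstrassCurve.LFunction`, whose prime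
coefficient is the HASSE–WEIL `a_ℓ`, `= ±1` at the multiplicative curve (Kraus–Oesterlé, Math. Ann. 293, p. 263 L8–9) — instead of the
tree's `frobeniusTrace` (`= 2 / 0` there, `X11b.LocalTorsion.frobeniusTrace_eq_two_of_split` / `…_zero_of_nonsplit`), which made the
original's `hcong` unsatisfiable at the simple prime(s) ℓ ∈ {3, 7} of `N_E·N_A` and the original VACUOUS AS TYPED. Hasse–Weil `a_ℓ` is the
currency in which the two engines (PARI `ellap`; ENGINE D pure-Python BSGS/Mestre; kit j130867) CERTIFIED the list: no certificate changes.
Per pair; nothing booked; X9 stays typed. [cite: KrausOesterle1992, Prop. 4 (ii), pp. 263–264] [cite: GreenbergVatsal2000, Thm. (1.4) (arXiv p. 5)]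
[cite: Cremona2006, Table 1 (Cremona labels 129472cz1, 55488cs1)] -/
theorem bsdp_t129472cz1_of_bsdp_s55488cs1_hasseWeil
    (hKO : KrausOesterle1992.prop4_torsionIso_of_congruences_hasseWeil)
    (hBCS : burungale_castella_skinner_charIdeal_eq_padicLFunction)
    (hGr : greenberg_charValue_rankZero) (h5 : realPeriodRat_eq_unit_mul_plusPeriod)
    (hGV : GreenbergVatsal2000.thm14_mainConjecture_transfer_of_torsionIso)
    (hS : Schneider1985_order_charGenerator) (hPR : perrinRiou_rankOne_leadingTerms)
    (hmodP : nonempty_modularParametrizationData) (hmodL : hasEntireLFunction_rat)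
    (hGZK : rank_eq_analyticRank_of_analyticRank_le_one)
    (W A : WeierstrassCurve ℚ) [W.IsElliptic] [W.IsGloballyMinimal] [A.IsElliptic] [A.IsGloballyMinimal]
    [Fact (Nat.Prime 5)]
    (hW : W = ⟨0, 1, 0, -4120369, -3014415185⟩) (hA : A = ⟨0, -1, 0, 91, -267⟩)
    (hran : W.analyticRank ≤ 1) (hrA : A.analyticRank ≤ 1) (hbsdA : BSDp A 5)
    (hSchA : A.analyticRank = 1 → ∀ Dh : PAdicHeightData A 5, Dh.IsCanonical → SchneiderConjecture Dh)
    (hcertA : ∀ [NeZero (A.conductorNorm ℤ)] (fA : CuspForm (Gamma0 (A.conductorNorm ℤ)) 2),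
        IsNewformOf A fA → ∀ (ϖ : ℚ), (ϖ : ℝ) * A.realPeriodRat = plusPeriod fA →
      ∃ n : ℕ, ‖PowerSeries.coeff n
        (PowerSeries.C (ϖ : ℚ_[5]) * padicLFunction fA (unitRoot A 5 : ℚ_[5]))‖ = 1)
    (hcong : ∀ (ℓ : ℕ) [Fact ℓ.Prime],
      6 * ℓ < KrausOesterle1992.gammaZeroIndex (KrausOesterle1992.modulus W A) →
      (padicValNat ℓ (W.conductorNorm ℤ * A.conductorNorm ℤ) = 0 →
          (5 : ℤ) ∣ W.frobeniusTrace ℓ - A.frobeniusTrace ℓ) ∧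
        (padicValNat ℓ (W.conductorNorm ℤ * A.conductorNorm ℤ) = 1 →
          (5 : ℤ) ∣ W.LFunction ℓ * A.LFunction ℓ - (ℓ + 1)))
    (hC3 : W.analyticRank = 1 → ∀ Dh : PAdicHeightData W 5, Dh.IsCanonical → SchneiderConjecture Dh) :
    BSDp W 5 := by
  have hIW : integralModelInt W = ⟨0, 1, 0, -4120369, -3014415185⟩ :=
    integralModelInt_eq_of_map_eq _ (by rw [hW]; ext <;> simp [WeierstrassCurve.map])
  have hIA : integralModelInt A = ⟨0, -1, 0, 91, -267⟩ :=
    integralModelInt_eq_of_map_eq _ (by rw [hA]; ext <;> simp [WeierstrassCurve.map])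
  haveI : Fact (Nat.Prime 11) := ⟨by norm_num⟩
  exact bsdp_of_ainvs_of_bsdpPartner_of_congruences_of_analyticRank_le_one_hasseWeil hKO hBCS hGr h5 hGV hS hPR hmodP hmodL hGZK
    0 1 0 (-4120369) (-3014415185) hIW
    0 (-1) 0 91 (-267) hIA
    5 11 8 8 8 (by norm_num) (by decide +kernel) card_t129472cz1_5 (by decide) (by decide)
    (by decide +kernel) card_t129472cz1_11 (by decide) (by decide +kernel) card_s55488cs1_5 (by decide)
    hran hrA hbsdA hSchA hcertA hcong hC3

/-- **`BSD(E,5)`-side record for `169932f1` from `56644j1`, RE-KEYED on the Hasse–Weil twin of Kraus–Oesterlé Prop. 4** (ARM-P register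
R-20 `KO92-Prop4-(ii)b-frobeniusTrace-offset`; x9 GEN 47 census `HOME/b2b-bsdres-x9/g47/KO92-EXPOSURE-X9.md`): the record
`bsdp_t169932f1_of_bsdp_s56644j1` of `X9/TransportSweepB.lean` — same Cremona models, same kernel-decided data (its `card_*` / `isElliptic_*` /
`isGloballyMinimal_*` theorems are imported, not re-proved), same PUBLISHED and FINITE binders (see that docstring for every number) —
with (i) `hKO` := the corrected statement `KrausOesterle1992.prop4_torsionIso_of_congruences_hasseWeil` and (ii) the `v_ℓ(N_E N_A) = 1`
conjunct of the displayed list `hcong` over `W.LFunction ℓ * A.LFunction ℓ` — Mathlib's `WeierstrassCurve.LFunction`, whose prime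
coefficient is the HASSE–WEIL `a_ℓ`, `= ±1` at the multiplicative curve (Kraus–Oesterlé, Math. Ann. 293, p. 263 L8–9) — instead of the
tree's `frobeniusTrace` (`= 2 / 0` there, `X11b.LocalTorsion.frobeniusTrace_eq_two_of_split` / `…_zero_of_nonsplit`), which made the
original's `hcong` unsatisfiable at the simple prime(s) ℓ ∈ {3} of `N_E·N_A` and the original VACUOUS AS TYPED. Hasse–Weil `a_ℓ` is the
currency in which the two engines (PARI `ellap`; ENGINE D pure-Python BSGS/Mestre; kit j130867) CERTIFIED the list: no certificate changes.
Per pair; nothing booked; X9 stays typed. [cite: KrausOesterle1992, Prop. 4 (ii), pp. 263–264] [cite: GreenbergVatsal2000, Thm. (1.4) (arXiv p. 5)]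
[cite: Cremona2006, Table 1 (Cremona labels 169932f1, 56644j1)] -/
theorem bsdp_t169932f1_of_bsdp_s56644j1_hasseWeil
    (hKO : KrausOesterle1992.prop4_torsionIso_of_congruences_hasseWeil)
    (hBCS : burungale_castella_skinner_charIdeal_eq_padicLFunction)
    (hGr : greenberg_charValue_rankZero) (h5 : realPeriodRat_eq_unit_mul_plusPeriod)
    (hGV : GreenbergVatsal2000.thm14_mainConjecture_transfer_of_torsionIso)
    (hS : Schneider1985_order_charGenerator) (hPR : perrinRiou_rankOne_leadingTerms)
    (hmodP : nonempty_modularParametrizationData) (hmodL : hasEntireLFunction_rat)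
    (hGZK : rank_eq_analyticRank_of_analyticRank_le_one)
    (W A : WeierstrassCurve ℚ) [W.IsElliptic] [W.IsGloballyMinimal] [A.IsElliptic] [A.IsGloballyMinimal]
    [Fact (Nat.Prime 5)]
    (hW : W = ⟨0, 1, 0, 1111, -9780⟩) (hA : A = ⟨0, -1, 0, -50474524, -129167339272⟩)
    (hran : W.analyticRank ≤ 1) (hrA : A.analyticRank ≤ 1) (hbsdA : BSDp A 5)
    (hSchA : A.analyticRank = 1 → ∀ Dh : PAdicHeightData A 5, Dh.IsCanonical → SchneiderConjecture Dh)
    (hcertA : ∀ [NeZero (A.conductorNorm ℤ)] (fA : CuspForm (Gamma0 (A.conductorNorm ℤ)) 2),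
        IsNewformOf A fA → ∀ (ϖ : ℚ), (ϖ : ℝ) * A.realPeriodRat = plusPeriod fA →
      ∃ n : ℕ, ‖PowerSeries.coeff n
        (PowerSeries.C (ϖ : ℚ_[5]) * padicLFunction fA (unitRoot A 5 : ℚ_[5]))‖ = 1)
    (hcong : ∀ (ℓ : ℕ) [Fact ℓ.Prime],
      6 * ℓ < KrausOesterle1992.gammaZeroIndex (KrausOesterle1992.modulus W A) →
      (padicValNat ℓ (W.conductorNorm ℤ * A.conductorNorm ℤ) = 0 →
          (5 : ℤ) ∣ W.frobeniusTrace ℓ - A.frobeniusTrace ℓ) ∧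
        (padicValNat ℓ (W.conductorNorm ℤ * A.conductorNorm ℤ) = 1 →
          (5 : ℤ) ∣ W.LFunction ℓ * A.LFunction ℓ - (ℓ + 1)))
    (hC3 : W.analyticRank = 1 → ∀ Dh : PAdicHeightData W 5, Dh.IsCanonical → SchneiderConjecture Dh) :
    BSDp W 5 := by
  have hIW : integralModelInt W = ⟨0, 1, 0, 1111, -9780⟩ :=
    integralModelInt_eq_of_map_eq _ (by rw [hW]; ext <;> simp [WeierstrassCurve.map])
  have hIA : integralModelInt A = ⟨0, -1, 0, -50474524, -129167339272⟩ :=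
    integralModelInt_eq_of_map_eq _ (by rw [hA]; ext <;> simp [WeierstrassCurve.map])
  haveI : Fact (Nat.Prime 11) := ⟨by norm_num⟩
  exact bsdp_of_ainvs_of_bsdpPartner_of_congruences_of_analyticRank_le_one_hasseWeil hKO hBCS hGr h5 hGV hS hPR hmodP hmodL hGZK
    0 1 0 1111 (-9780) hIW
    0 (-1) 0 (-50474524) (-129167339272) hIA
    5 11 8 8 8 (by norm_num) (by decide +kernel) card_t169932f1_5 (by decide) (by decide)
    (by decide +kernel) card_t169932f1_11 (by decide) (by decide +kernel) card_s56644j1_5 (by decide)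
    hran hrA hbsdA hSchA hcertA hcong hC3

/-- **`BSD(E,5)`-side record for `17328j1` from `5776a1`, RE-KEYED on the Hasse–Weil twin of Kraus–Oesterlé Prop. 4** (ARM-P register
R-20 `KO92-Prop4-(ii)b-frobeniusTrace-offset`; x9 GEN 47 census `HOME/b2b-bsdres-x9/g47/KO92-EXPOSURE-X9.md`): the record
`bsdp_t17328j1_of_bsdp_s5776a1` of `X9/TransportSweepB.lean` — same Cremona models, same kernel-decided data (its `card_*` / `isElliptic_*` /
`isGloballyMinimal_*` theorems are imported, not re-proved), same PUBLISHED and FINITE binders (see that docstring for every number) —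
with (i) `hKO` := the corrected statement `KrausOesterle1992.prop4_torsionIso_of_congruences_hasseWeil` and (ii) the `v_ℓ(N_E N_A) = 1`
conjunct of the displayed list `hcong` over `W.LFunction ℓ * A.LFunction ℓ` — Mathlib's `WeierstrassCurve.LFunction`, whose prime
coefficient is the HASSE–WEIL `a_ℓ`, `= ±1` at the multiplicative curve (Kraus–Oesterlé, Math. Ann. 293, p. 263 L8–9) — instead of the
tree's `frobeniusTrace` (`= 2 / 0` there, `X11b.LocalTorsion.frobeniusTrace_eq_two_of_split` / `…_zero_of_nonsplit`), which made the
original's `hcong` unsatisfiable at the simple prime(s) ℓ ∈ {3} of `N_E·N_A` and the original VACUOUS AS TYPED. Hasse–Weil `a_ℓ` is the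
currency in which the two engines (PARI `ellap`; ENGINE D pure-Python BSGS/Mestre; kit j130867) CERTIFIED the list: no certificate changes.
Per pair; nothing booked; X9 stays typed. [cite: KrausOesterle1992, Prop. 4 (ii), pp. 263–264] [cite: GreenbergVatsal2000, Thm. (1.4) (arXiv p. 5)]
[cite: Cremona2006, Table 1 (Cremona labels 17328j1, 5776a1)] -/
theorem bsdp_t17328j1_of_bsdp_s5776a1_hasseWeil
    (hKO : KrausOesterle1992.prop4_torsionIso_of_congruences_hasseWeil)
    (hBCS : burungale_castella_skinner_charIdeal_eq_padicLFunction)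
    (hGr : greenberg_charValue_rankZero) (h5 : realPeriodRat_eq_unit_mul_plusPeriod)
    (hGV : GreenbergVatsal2000.thm14_mainConjecture_transfer_of_torsionIso)
    (hS : Schneider1985_order_charGenerator) (hPR : perrinRiou_rankOne_leadingTerms)
    (hmodP : nonempty_modularParametrizationData) (hmodL : hasEntireLFunction_rat)
    (hGZK : rank_eq_analyticRank_of_analyticRank_le_one)
    (W A : WeierstrassCurve ℚ) [W.IsElliptic] [W.IsGloballyMinimal] [A.IsElliptic] [A.IsGloballyMinimal]
    [Fact (Nat.Prime 5)]
    (hW : W = ⟨0, 1, 0, -16004, 1741932⟩) (hA : A = ⟨0, -1, 0, -153184, -23025409⟩)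
    (hran : W.analyticRank ≤ 1) (hrA : A.analyticRank ≤ 1) (hbsdA : BSDp A 5)
    (hSchA : A.analyticRank = 1 → ∀ Dh : PAdicHeightData A 5, Dh.IsCanonical → SchneiderConjecture Dh)
    (hcertA : ∀ [NeZero (A.conductorNorm ℤ)] (fA : CuspForm (Gamma0 (A.conductorNorm ℤ)) 2),
        IsNewformOf A fA → ∀ (ϖ : ℚ), (ϖ : ℝ) * A.realPeriodRat = plusPeriod fA →
      ∃ n : ℕ, ‖PowerSeries.coeff n
        (PowerSeries.C (ϖ : ℚ_[5]) * padicLFunction fA (unitRoot A 5 : ℚ_[5]))‖ = 1)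
    (hcong : ∀ (ℓ : ℕ) [Fact ℓ.Prime],
      6 * ℓ < KrausOesterle1992.gammaZeroIndex (KrausOesterle1992.modulus W A) →
      (padicValNat ℓ (W.conductorNorm ℤ * A.conductorNorm ℤ) = 0 →
          (5 : ℤ) ∣ W.frobeniusTrace ℓ - A.frobeniusTrace ℓ) ∧
        (padicValNat ℓ (W.conductorNorm ℤ * A.conductorNorm ℤ) = 1 →
          (5 : ℤ) ∣ W.LFunction ℓ * A.LFunction ℓ - (ℓ + 1)))
    (hC3 : W.analyticRank = 1 → ∀ Dh : PAdicHeightData W 5, Dh.IsCanonical → SchneiderConjecture Dh) :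
    BSDp W 5 := by
  have hIW : integralModelInt W = ⟨0, 1, 0, -16004, 1741932⟩ :=
    integralModelInt_eq_of_map_eq _ (by rw [hW]; ext <;> simp [WeierstrassCurve.map])
  have hIA : integralModelInt A = ⟨0, -1, 0, -153184, -23025409⟩ :=
    integralModelInt_eq_of_map_eq _ (by rw [hA]; ext <;> simp [WeierstrassCurve.map])
  haveI : Fact (Nat.Prime 7) := ⟨by norm_num⟩
  exact bsdp_of_ainvs_of_bsdpPartner_of_congruences_of_analyticRank_le_one_hasseWeil hKO hBCS hGr h5 hGV hS hPR hmodP hmodL hGZK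
    0 1 0 (-16004) 1741932 hIW
    0 (-1) 0 (-153184) (-23025409) hIA
    5 7 3 8 3 (by norm_num) (by decide +kernel) card_t17328j1_5 (by decide) (by decide)
    (by decide +kernel) card_t17328j1_7 (by decide) (by decide +kernel) card_s5776a1_5 (by decide)
    hran hrA hbsdA hSchA hcertA hcong hC3

/-- **`BSD(E,5)`-side record for `177744dj1` from `8464f1`, RE-KEYED on the Hasse–Weil twin of Kraus–Oesterlé Prop. 4** (ARM-P register
R-20 `KO92-Prop4-(ii)b-frobeniusTrace-offset`; x9 GEN 47 census `HOME/b2b-bsdres-x9/g47/KO92-EXPOSURE-X9.md`): the record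
`bsdp_t177744dj1_of_bsdp_s8464f1` of `X9/TransportSweepC.lean` — same Cremona models, same kernel-decided data (its `card_*` / `isElliptic_*` /
`isGloballyMinimal_*` theorems are imported, not re-proved), same PUBLISHED and FINITE binders (see that docstring for every number) —
with (i) `hKO` := the corrected statement `KrausOesterle1992.prop4_torsionIso_of_congruences_hasseWeil` and (ii) the `v_ℓ(N_E N_A) = 1`
conjunct of the displayed list `hcong` over `W.LFunction ℓ * A.LFunction ℓ` — Mathlib's `WeierstrassCurve.LFunction`, whose prime
coefficient is the HASSE–WEIL `a_ℓ`, `= ±1` at the multiplicative curve (Kraus–Oesterlé, Math. Ann. 293, p. 263 L8–9) — instead of the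
tree's `frobeniusTrace` (`= 2 / 0` there, `X11b.LocalTorsion.frobeniusTrace_eq_two_of_split` / `…_zero_of_nonsplit`), which made the
original's `hcong` unsatisfiable at the simple prime(s) ℓ ∈ {3, 7} of `N_E·N_A` and the original VACUOUS AS TYPED. Hasse–Weil `a_ℓ` is the
currency in which the two engines (PARI `ellap`; ENGINE D pure-Python BSGS/Mestre; kit j130867) CERTIFIED the list: no certificate changes.
Per pair; nothing booked; X9 stays typed. [cite: KrausOesterle1992, Prop. 4 (ii), pp. 263–264] [cite: GreenbergVatsal2000, Thm. (1.4) (arXiv p. 5)]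
[cite: Cremona2006, Table 1 (Cremona labels 177744dj1, 8464f1)] -/
theorem bsdp_t177744dj1_of_bsdp_s8464f1_hasseWeil
    (hKO : KrausOesterle1992.prop4_torsionIso_of_congruences_hasseWeil)
    (hBCS : burungale_castella_skinner_charIdeal_eq_padicLFunction)
    (hGr : greenberg_charValue_rankZero) (h5 : realPeriodRat_eq_unit_mul_plusPeriod)
    (hGV : GreenbergVatsal2000.thm14_mainConjecture_transfer_of_torsionIso)
    (hS : Schneider1985_order_charGenerator) (hPR : perrinRiou_rankOne_leadingTerms)
    (hmodP : nonempty_modularParametrizationData) (hmodL : hasEntireLFunction_rat)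
    (hGZK : rank_eq_analyticRank_of_analyticRank_le_one)
    (W A : WeierstrassCurve ℚ) [W.IsElliptic] [W.IsGloballyMinimal] [A.IsElliptic] [A.IsGloballyMinimal]
    [Fact (Nat.Prime 5)]
    (hW : W = ⟨0, -1, 0, -1030139, 387778062⟩) (hA : A = ⟨0, 1, 0, 4056, -599788⟩)
    (hran : W.analyticRank ≤ 1) (hrA : A.analyticRank ≤ 1) (hbsdA : BSDp A 5)
    (hSchA : A.analyticRank = 1 → ∀ Dh : PAdicHeightData A 5, Dh.IsCanonical → SchneiderConjecture Dh)
    (hcertA : ∀ [NeZero (A.conductorNorm ℤ)] (fA : CuspForm (Gamma0 (A.conductorNorm ℤ)) 2),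
        IsNewformOf A fA → ∀ (ϖ : ℚ), (ϖ : ℝ) * A.realPeriodRat = plusPeriod fA →
      ∃ n : ℕ, ‖PowerSeries.coeff n
        (PowerSeries.C (ϖ : ℚ_[5]) * padicLFunction fA (unitRoot A 5 : ℚ_[5]))‖ = 1)
    (hcong : ∀ (ℓ : ℕ) [Fact ℓ.Prime],
      6 * ℓ < KrausOesterle1992.gammaZeroIndex (KrausOesterle1992.modulus W A) →
      (padicValNat ℓ (W.conductorNorm ℤ * A.conductorNorm ℤ) = 0 →
          (5 : ℤ) ∣ W.frobeniusTrace ℓ - A.frobeniusTrace ℓ) ∧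
        (padicValNat ℓ (W.conductorNorm ℤ * A.conductorNorm ℤ) = 1 →
          (5 : ℤ) ∣ W.LFunction ℓ * A.LFunction ℓ - (ℓ + 1)))
    (hC3 : W.analyticRank = 1 → ∀ Dh : PAdicHeightData W 5, Dh.IsCanonical → SchneiderConjecture Dh) :
    BSDp W 5 := by
  have hIW : integralModelInt W = ⟨0, -1, 0, -1030139, 387778062⟩ :=
    integralModelInt_eq_of_map_eq _ (by rw [hW]; ext <;> simp [WeierstrassCurve.map])
  have hIA : integralModelInt A = ⟨0, 1, 0, 4056, -599788⟩ :=
    integralModelInt_eq_of_map_eq _ (by rw [hA]; ext <;> simp [WeierstrassCurve.map])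
  haveI : Fact (Nat.Prime 11) := ⟨by norm_num⟩
  exact bsdp_of_ainvs_of_bsdpPartner_of_congruences_of_analyticRank_le_one_hasseWeil hKO hBCS hGr h5 hGV hS hPR hmodP hmodL hGZK
    0 (-1) 0 (-1030139) 387778062 hIW
    0 1 0 4056 (-599788) hIA
    5 11 16 3 8 (by norm_num) (by decide +kernel) card_t177744dj1_5 (by decide) (by decide)
    (by decide +kernel) card_t177744dj1_11 (by decide) (by decide +kernel) card_s8464f1_5 (by decide)
    hran hrA hbsdA hSchA hcertA hcong hC3

/-- **`BSD(E,5)`-side record for `184512bq1` from `61504r1`, RE-KEYED on the Hasse–Weil twin of Kraus–Oesterlé Prop. 4** (ARM-P register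
R-20 `KO92-Prop4-(ii)b-frobeniusTrace-offset`; x9 GEN 47 census `HOME/b2b-bsdres-x9/g47/KO92-EXPOSURE-X9.md`): the record
`bsdp_t184512bq1_of_bsdp_s61504r1` of `X9/TransportSweepC.lean` — same Cremona models, same kernel-decided data (its `card_*` / `isElliptic_*` /
`isGloballyMinimal_*` theorems are imported, not re-proved), same PUBLISHED and FINITE binders (see that docstring for every number) —
with (i) `hKO` := the corrected statement `KrausOesterle1992.prop4_torsionIso_of_congruences_hasseWeil` and (ii) the `v_ℓ(N_E N_A) = 1`
conjunct of the displayed list `hcong` over `W.LFunction ℓ * A.LFunction ℓ` — Mathlib's `WeierstrassCurve.LFunction`, whose prime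
coefficient is the HASSE–WEIL `a_ℓ`, `= ±1` at the multiplicative curve (Kraus–Oesterlé, Math. Ann. 293, p. 263 L8–9) — instead of the
tree's `frobeniusTrace` (`= 2 / 0` there, `X11b.LocalTorsion.frobeniusTrace_eq_two_of_split` / `…_zero_of_nonsplit`), which made the
original's `hcong` unsatisfiable at the simple prime(s) ℓ ∈ {3} of `N_E·N_A` and the original VACUOUS AS TYPED. Hasse–Weil `a_ℓ` is the
currency in which the two engines (PARI `ellap`; ENGINE D pure-Python BSGS/Mestre; kit j130867) CERTIFIED the list: no certificate changes.
Per pair; nothing booked; X9 stays typed. [cite: KrausOesterle1992, Prop. 4 (ii), pp. 263–264] [cite: GreenbergVatsal2000, Thm. (1.4) (arXiv p. 5)]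
[cite: Cremona2006, Table 1 (Cremona labels 184512bq1, 61504r1)] -/
theorem bsdp_t184512bq1_of_bsdp_s61504r1_hasseWeil
    (hKO : KrausOesterle1992.prop4_torsionIso_of_congruences_hasseWeil)
    (hBCS : burungale_castella_skinner_charIdeal_eq_padicLFunction)
    (hGr : greenberg_charValue_rankZero) (h5 : realPeriodRat_eq_unit_mul_plusPeriod)
    (hGV : GreenbergVatsal2000.thm14_mainConjecture_transfer_of_torsionIso)
    (hS : Schneider1985_order_charGenerator) (hPR : perrinRiou_rankOne_leadingTerms)
    (hmodP : nonempty_modularParametrizationData) (hmodL : hasEntireLFunction_rat)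
    (hGZK : rank_eq_analyticRank_of_analyticRank_le_one)
    (W A : WeierstrassCurve ℚ) [W.IsElliptic] [W.IsGloballyMinimal] [A.IsElliptic] [A.IsGloballyMinimal]
    [Fact (Nat.Prime 5)]
    (hW : W = ⟨0, 1, 0, 2811, 721827⟩) (hA : A = ⟨0, -1, 0, -289, -1759⟩)
    (hran : W.analyticRank ≤ 1) (hrA : A.analyticRank ≤ 1) (hbsdA : BSDp A 5)
    (hSchA : A.analyticRank = 1 → ∀ Dh : PAdicHeightData A 5, Dh.IsCanonical → SchneiderConjecture Dh)
    (hcertA : ∀ [NeZero (A.conductorNorm ℤ)] (fA : CuspForm (Gamma0 (A.conductorNorm ℤ)) 2),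
        IsNewformOf A fA → ∀ (ϖ : ℚ), (ϖ : ℝ) * A.realPeriodRat = plusPeriod fA →
      ∃ n : ℕ, ‖PowerSeries.coeff n
        (PowerSeries.C (ϖ : ℚ_[5]) * padicLFunction fA (unitRoot A 5 : ℚ_[5]))‖ = 1)
    (hcong : ∀ (ℓ : ℕ) [Fact ℓ.Prime],
      6 * ℓ < KrausOesterle1992.gammaZeroIndex (KrausOesterle1992.modulus W A) →
      (padicValNat ℓ (W.conductorNorm ℤ * A.conductorNorm ℤ) = 0 →
          (5 : ℤ) ∣ W.frobeniusTrace ℓ - A.frobeniusTrace ℓ) ∧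
        (padicValNat ℓ (W.conductorNorm ℤ * A.conductorNorm ℤ) = 1 →
          (5 : ℤ) ∣ W.LFunction ℓ * A.LFunction ℓ - (ℓ + 1)))
    (hC3 : W.analyticRank = 1 → ∀ Dh : PAdicHeightData W 5, Dh.IsCanonical → SchneiderConjecture Dh) :
    BSDp W 5 := by
  have hIW : integralModelInt W = ⟨0, 1, 0, 2811, 721827⟩ :=
    integralModelInt_eq_of_map_eq _ (by rw [hW]; ext <;> simp [WeierstrassCurve.map])
  have hIA : integralModelInt A = ⟨0, -1, 0, -289, -1759⟩ :=
    integralModelInt_eq_of_map_eq _ (by rw [hA]; ext <;> simp [WeierstrassCurve.map])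
  haveI : Fact (Nat.Prime 7) := ⟨by norm_num⟩
  exact bsdp_of_ainvs_of_bsdpPartner_of_congruences_of_analyticRank_le_one_hasseWeil hKO hBCS hGr h5 hGV hS hPR hmodP hmodL hGZK
    0 1 0 2811 721827 hIW
    0 (-1) 0 (-289) (-1759) hIA
    5 7 8 8 3 (by norm_num) (by decide +kernel) card_t184512bq1_5 (by decide) (by decide)
    (by decide +kernel) card_t184512bq1_7 (by decide) (by decide +kernel) card_s61504r1_5 (by decide)
    hran hrA hbsdA hSchA hcertA hcong hC3

end Summit.BirchSwinnertonDyer.Rank1Residual.X9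

end
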